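import Mathlib
import Summits.ValiantsHypothesis.ValiantsHypothesis.Theorems.NewtonUnitEquationsDissociatedUniformTotalsLawUnimodal
import HarnessLib

/-!
# Crux `NewtonUnitEquations.DissociatedUniform` (stmt-ValiantsHypothesis-5905): the `n = 3` totals law for third curves with few jumps on the convexly ordered stratum

Companion of `…TotalsLawUnimodal` (`ConvexlyOrdered`, `bdry`, and the pointwise union law
`unionVert_le_of_convexlyOrdered : #vert conv U_s(Z) ≤ 2q + ∑_{z ∈ bdry Z} V(P_{s-z})` for both curves convexly ordered).  Here the
two consumers promised there:
* INTERVALS (`interval q L = {0, …, L-1} ⊆ ℤ/q`, `card_bdry_interval_le_two`): **`unionTotal_interval_le`** `UT ≤ 2q² + 2 V_P ≤ 4q²`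
  and **`unionVert_interval_le`** `#vert conv U_s ≤ 4q` for every window of `L` consecutive fibres, every `L` — the interval case
  (R4′) of memo `Cruxes/DissociatedUniform/NOTES-t1g4.md` §4 on the convexly ordered stratum (the census-maximal family of §5 there).
* THE CLASS LAW (`jumps c` = positions `z` with `c (z+1) ≠ c z`; `sum_card_bdry_level_le`: the level sets of `c` have at most
  `2·#jumps` run endpoints in total): by the level-set decomposition `totalVert_le_sum_unionTotal` of `…TotalsLawUnion`,
  **`totalVert_le_of_convexlyOrdered`**: `T(a,b,c) ≤ 2·m·q² + 2·J·V_P ≤ 2(m + J)·q²` for ANY third curve `c` with `m` values and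
  `J` jumps, both `a, b` convexly ordered; e.g. (`totalVert_indicator_interval_le`) a two-valued third curve with an interval level
  set has `T ≤ 8q²`.  So on this stratum the `n = 3` law holds with a constant linear in the number of jumps of the third curve.
Honest label: stratum theorems; `TotalsLawThree C` itself (arbitrary labellings, arbitrary `c`) remains OPEN; nothing here bears
on VP ≠ VNP.
[folklore]
-/

set_option linter.dupNamespace false -- `ValiantsHypothesis.ValiantsHypothesis` (summit = problem) in every name

open scoped BigOperators Pointwise

namespace Summit.ValiantsHypothesis.ValiantsHypothesis.Theorems.NewtonUnitEquationsDissociatedUniform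

namespace TotalsLaw

open Literature.Computability.AlgebraicComplexity.KPTT.PlanarMinkowski

section Classes

variable {q : ℕ} [NeZero q]

/-! ### Intervals -/

/-- The interval of positions `{0, 1, …, L - 1} ⊆ ℤ/q` (the first `L` labels). -/
def interval (q L : ℕ) : Finset (ZMod q) := (Finset.range L).image fun k : ℕ => (k : ZMod q)

omit [NeZero q] in
/-- An interval has at most two run endpoints (`0` and `L - 1`). [folklore] -/
theorem card_bdry_interval_le_two (L : ℕ) : (bdry (interval q L)).card ≤ 2 := by
  classical
  have hsub : bdry (interval q L) ⊆ {((0 : ℕ) : ZMod q), ((L - 1 : ℕ) : ZMod q)} := by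
    intro z hz
    obtain ⟨hzZ, hzb⟩ := Finset.mem_filter.1 hz
    obtain ⟨k, hk, rfl⟩ := Finset.mem_image.1 hzZ
    rw [Finset.mem_range] at hk
    rw [Finset.mem_insert, Finset.mem_singleton]
    rcases hzb with h | h
    · -- `k + 1` is not a position, so `k = L - 1`
      right
      have : ¬ (k + 1 < L) := fun hlt => h (Finset.mem_image.2 ⟨k + 1, Finset.mem_range.2 hlt, by push_cast; ring⟩)
      congr 1; omega
    · -- `k - 1` is not a position, so `k = 0`
      left
      by_contra hk0
      have hk1 : 1 ≤ k := by
        by_contra h1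
        exact hk0 (by rw [show k = 0 by omega])
      exact h (Finset.mem_image.2 ⟨k - 1, Finset.mem_range.2 (by omega), by rw [Nat.cast_sub hk1]; push_cast; ring⟩)
  exact (Finset.card_le_card hsub).trans Finset.card_le_two

variable (a b : ZMod q → (Fin 2 → ℝ))

/-- **The interval case** (memo NOTES-t1g4 (R4′), on the convexly ordered stratum): for both curves convexly ordered and `Z` the
interval of the first `L` positions (any `L`), `unionTotal ≤ 2q² + 2·V_P ≤ 4q²`. [folklore] -/
theorem unionTotal_interval_le (ha : ConvexlyOrdered a) (hb : ConvexlyOrdered b) (L : ℕ) :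
    unionTotal a b (interval q L : Set (ZMod q)) ≤ 2 * q ^ 2 + 2 * fibreTotal a b ∧
      unionTotal a b (interval q L : Set (ZMod q)) ≤ 4 * q ^ 2 := by
  have h1 := unionTotal_le_of_convexlyOrdered a b ha hb (interval q L)
  have h2 := card_bdry_interval_le_two (q := q) L
  have h3 := fibreTotal_le_card_sq a b
  rw [ZMod.card] at h3
  have hA : unionTotal a b (interval q L : Set (ZMod q)) ≤ 2 * q ^ 2 + 2 * fibreTotal a b :=
    h1.trans (by gcongr)
  exact ⟨hA, hA.trans (by nlinarith)⟩

/-- Pointwise interval bound: `#vert conv U_s ≤ 4q` for every window of `L` consecutive fibres. [folklore] -/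
theorem unionVert_interval_le (ha : ConvexlyOrdered a) (hb : ConvexlyOrdered b) (L : ℕ) (s : ZMod q) :
    unionVert a b (interval q L : Set (ZMod q)) s ≤ 4 * q := by
  have h1 := unionVert_le_of_convexlyOrdered' a b ha hb (interval q L) s
  have h2 := card_bdry_interval_le_two (q := q) L
  calc unionVert a b (interval q L : Set (ZMod q)) s ≤ (2 + (bdry (interval q L)).card) * q := h1
    _ ≤ (2 + 2) * q := by gcongr
    _ = 4 * q := by norm_num

/-! ### Level sets and jumps of a third curve -/

/-- The level set `c⁻¹(v)` as a finite position set. -/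
noncomputable def levelFin (c : ZMod q → (Fin 2 → ℝ)) (v : Fin 2 → ℝ) : Finset (ZMod q) :=
  Finset.univ.filter fun z => c z = v

/-- The JUMPS of a third curve: positions `z` with `c (z + 1) ≠ c z`. -/
noncomputable def jumps (c : ZMod q → (Fin 2 → ℝ)) : Finset (ZMod q) := Finset.univ.filter fun z => c (z + 1) ≠ c z

/-- The carrier of `levelFin c v` is the preimage `c ⁻¹' {v}`. [folklore] -/
theorem coe_levelFin (c : ZMod q → (Fin 2 → ℝ)) (v : Fin 2 → ℝ) : (levelFin c v : Set (ZMod q)) = c ⁻¹' {v} := by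
  ext z
  simp [levelFin]

/-- **Level sets have few run endpoints**: summed over the values `v` of `c`, the level sets `c⁻¹(v)` have at most `2·#jumps c`
run endpoints (an endpoint `z` of a run of `c⁻¹(v)` has `c (z+1) ≠ c z` — a jump at `z` — or `c (z-1) ≠ c z` — a jump at `z - 1`).
[folklore] -/
theorem sum_card_bdry_level_le (c : ZMod q → (Fin 2 → ℝ)) :
    ∑ v ∈ Finset.univ.image c, (bdry (levelFin c v)).card ≤ 2 * (jumps c).card := by
  classical
  have hdisj : ((Finset.univ.image c : Finset (Fin 2 → ℝ)) : Set (Fin 2 → ℝ)).PairwiseDisjoint fun v => bdry (levelFin c v) := by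
    intro v _ v' _ hne
    rw [Function.onFun, Finset.disjoint_left]
    intro z hz hz'
    have h1 : c z = v := (Finset.mem_filter.1 (bdry_subset _ hz)).2
    have h2 : c z = v' := (Finset.mem_filter.1 (bdry_subset _ hz')).2
    exact hne (h1.symm.trans h2)
  rw [← Finset.card_biUnion hdisj]
  have hsub : (Finset.univ.image c).biUnion (fun v => bdry (levelFin c v)) ⊆ jumps c ∪ (jumps c).image fun z => z + 1 := by
    intro z hz
    obtain ⟨v, -, hzv⟩ := Finset.mem_biUnion.1 hz
    obtain ⟨hzL, hzb⟩ := Finset.mem_filter.1 hzv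
    have hcz : c z = v := (Finset.mem_filter.1 hzL).2
    rw [Finset.mem_union]
    rcases hzb with h | h
    · left
      refine Finset.mem_filter.2 ⟨Finset.mem_univ _, fun heq => h (Finset.mem_filter.2 ⟨Finset.mem_univ _, ?_⟩)⟩
      rw [heq, hcz]
    · right
      refine Finset.mem_image.2 ⟨z - 1, Finset.mem_filter.2 ⟨Finset.mem_univ _, fun heq => h
        (Finset.mem_filter.2 ⟨Finset.mem_univ _, ?_⟩)⟩, sub_add_cancel z 1⟩
      rw [sub_add_cancel] at heq
      rw [← heq, hcz]
  calc ((Finset.univ.image c).biUnion fun v => bdry (levelFin c v)).card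
      ≤ (jumps c ∪ (jumps c).image fun z => z + 1).card := Finset.card_le_card hsub
    _ ≤ (jumps c).card + ((jumps c).image fun z => z + 1).card := Finset.card_union_le _ _
    _ ≤ (jumps c).card + (jumps c).card := Nat.add_le_add_left Finset.card_image_le _
    _ = 2 * (jumps c).card := (two_mul _).symm

/-! ### The `n = 3` totals law for third curves with few jumps (both `a, b` convexly ordered) -/

/-- **`T(a,b,c) ≤ 2·m·q² + 2·J·V_P`** for `a, b` convexly ordered and ANY third curve `c` with `m` values and `J` jumps: the level-set
decomposition `V_s ≤ ∑_v #vert conv U_s(c⁻¹ v)` and the pointwise union law on this stratum. [folklore] -/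
theorem totalVert_le_of_convexlyOrdered (ha : ConvexlyOrdered a) (hb : ConvexlyOrdered b) (c : ZMod q → (Fin 2 → ℝ)) :
    totalVert a b c ≤ 2 * (Finset.univ.image c).card * q ^ 2 + 2 * (jumps c).card * fibreTotal a b := by
  classical
  have hlev : ∀ v ∈ Finset.univ.image c,
      unionTotal a b (c ⁻¹' {v}) ≤ 2 * q ^ 2 + (bdry (levelFin c v)).card * fibreTotal a b := by
    intro v _
    rw [← coe_levelFin c v]
    exact unionTotal_le_of_convexlyOrdered a b ha hb (levelFin c v)
  calc totalVert a b c ≤ ∑ v ∈ Finset.univ.image c, unionTotal a b (c ⁻¹' {v}) := totalVert_le_sum_unionTotal a b c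
    _ ≤ ∑ v ∈ Finset.univ.image c, (2 * q ^ 2 + (bdry (levelFin c v)).card * fibreTotal a b) := Finset.sum_le_sum hlev
    _ = (Finset.univ.image c).card * (2 * q ^ 2) + (∑ v ∈ Finset.univ.image c, (bdry (levelFin c v)).card) * fibreTotal a b := by
        rw [Finset.sum_add_distrib, Finset.sum_const, smul_eq_mul, Finset.sum_mul]
    _ ≤ (Finset.univ.image c).card * (2 * q ^ 2) + (2 * (jumps c).card) * fibreTotal a b := by
        gcongr
        exact sum_card_bdry_level_le c
    _ = 2 * (Finset.univ.image c).card * q ^ 2 + 2 * (jumps c).card * fibreTotal a b := by ring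

/-- Hence **`T(a,b,c) ≤ 2(m + J)·q²`**: on the convexly ordered stratum the `n = 3` totals law holds with a constant linear in the
number of values and jumps of the third curve. [folklore] -/
theorem totalVert_le_of_convexlyOrdered' (ha : ConvexlyOrdered a) (hb : ConvexlyOrdered b) (c : ZMod q → (Fin 2 → ℝ)) :
    totalVert a b c ≤ 2 * ((Finset.univ.image c).card + (jumps c).card) * q ^ 2 := by
  classical
  have h := fibreTotal_le_card_sq a b
  rw [ZMod.card] at h
  calc totalVert a b c ≤ 2 * (Finset.univ.image c).card * q ^ 2 + 2 * (jumps c).card * fibreTotal a b :=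
        totalVert_le_of_convexlyOrdered a b ha hb c
    _ ≤ 2 * (Finset.univ.image c).card * q ^ 2 + 2 * (jumps c).card * q ^ 2 := by gcongr
    _ = 2 * ((Finset.univ.image c).card + (jumps c).card) * q ^ 2 := by ring

/-! ### Example: a two-valued third curve with an interval level set -/

/-- The indicator-type third curve: `v₀` on the interval of the first `L` positions, `v₁` elsewhere. -/
noncomputable def indicatorCurve (q L : ℕ) (v₀ v₁ : Fin 2 → ℝ) (z : ZMod q) : Fin 2 → ℝ :=
  if z ∈ interval q L then v₀ else v₁

/-- It takes at most two values. [folklore] -/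
theorem card_image_indicatorCurve_le (L : ℕ) (v₀ v₁ : Fin 2 → ℝ) :
    (Finset.univ.image (indicatorCurve q L v₀ v₁)).card ≤ 2 := by
  classical
  have hsub : Finset.univ.image (indicatorCurve q L v₀ v₁) ⊆ {v₀, v₁} := by
    intro v hv
    obtain ⟨z, -, rfl⟩ := Finset.mem_image.1 hv
    unfold indicatorCurve
    split_ifs <;> simp
  exact (Finset.card_le_card hsub).trans Finset.card_le_two

/-- It has at most two jumps (at `L - 1` and at `-1`). [folklore] -/
theorem card_jumps_indicatorCurve_le (L : ℕ) (v₀ v₁ : Fin 2 → ℝ) : (jumps (indicatorCurve q L v₀ v₁)).card ≤ 2 := by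
  classical
  have hsub : jumps (indicatorCurve q L v₀ v₁) ⊆ {((L - 1 : ℕ) : ZMod q), (-1 : ZMod q)} := by
    intro z hz
    have hne := (Finset.mem_filter.1 hz).2
    rw [Finset.mem_insert, Finset.mem_singleton]
    unfold indicatorCurve at hne
    by_cases h0 : z ∈ interval q L
    · by_cases h1 : z + 1 ∈ interval q L
      · rw [if_pos h0, if_pos h1] at hne; exact absurd rfl hne
      · -- `z = k` with `k < L` and `k + 1 ∉ [0, L)`: `k = L - 1`
        left
        obtain ⟨k, hk, rfl⟩ := Finset.mem_image.1 h0
        rw [Finset.mem_range] at hk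
        have : ¬ (k + 1 < L) := fun hlt => h1 (Finset.mem_image.2 ⟨k + 1, Finset.mem_range.2 hlt, by push_cast; ring⟩)
        congr 1; omega
    · by_cases h1 : z + 1 ∈ interval q L
      · -- `z + 1 = k` with `k < L` and `k - 1 ∉ [0, L)`: `k = 0`
        right
        obtain ⟨k, hk, hkz⟩ := Finset.mem_image.1 h1
        rw [Finset.mem_range] at hk
        by_cases hk0 : k = 0
        · rw [hk0, Nat.cast_zero] at hkz
          linear_combination -hkz
        · have hk1 : 1 ≤ k := Nat.one_le_iff_ne_zero.2 hk0
          exact absurd (Finset.mem_image.2 ⟨k - 1, Finset.mem_range.2 (by omega),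
            by rw [Nat.cast_sub hk1, hkz]; push_cast; ring⟩) h0
      · rw [if_neg h0, if_neg h1] at hne; exact absurd rfl hne
  exact (Finset.card_le_card hsub).trans Finset.card_le_two

/-- **A two-valued third curve with an interval level set has `T ≤ 8q²`** (both `a, b` convexly ordered, any `L`, any two values).
[folklore] -/
theorem totalVert_indicator_interval_le (ha : ConvexlyOrdered a) (hb : ConvexlyOrdered b) (L : ℕ) (v₀ v₁ : Fin 2 → ℝ) :
    totalVert a b (indicatorCurve q L v₀ v₁) ≤ 8 * q ^ 2 := by
  have h := totalVert_le_of_convexlyOrdered' a b ha hb (indicatorCurve q L v₀ v₁)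
  have h1 := card_image_indicatorCurve_le (q := q) L v₀ v₁
  have h2 := card_jumps_indicatorCurve_le (q := q) L v₀ v₁
  calc totalVert a b (indicatorCurve q L v₀ v₁)
      ≤ 2 * ((Finset.univ.image (indicatorCurve q L v₀ v₁)).card + (jumps (indicatorCurve q L v₀ v₁)).card) * q ^ 2 := h
    _ ≤ 2 * (2 + 2) * q ^ 2 := by gcongr
    _ = 8 * q ^ 2 := by norm_num

end Classes

end TotalsLaw

end Summit.ValiantsHypothesis.ValiantsHypothesis.Theorems.NewtonUnitEquationsDissociatedUniform
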